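import Summits.HodgeConjecture.CorCM.CyclotomicTwoPowerPResidueDescent
import HarnessLib

/-!
# `ω²` is not a norm of DEGREE FOUR from `ℤ[ζ_{2^{a+1}p}]` to the fixed ring of `ζ ↦ ζ^e` (`e ≡ 1 (mod 2^{a+1})`,
# `e² ≡ −1 (mod p)`): the residue-field descent with fourth powers

COR-CM (cell `pub-hodgecm2`), binder seat b04 (gen 26), count-neutral — groundwork for the gen-26 FRONTIER «metacyclic groups
`C_p ⋊_r C_{2^m}` with an action of ORDER FOUR» (A7-JUNCTION gen-26 addendum §C and the «semilinear determinant trick»): for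
`G = C_p ⋊_r C_{2^m}`, `r² ≡ −1 (mod p)`, the annihilator blocks are left multiplications in the cyclic algebra
`𝔄 = (L/L₀, σ, ω)` of degree `4`, `L = ℚ(ζ_{2^{a+1}p})` (`a + 1 = m − 2`), `σ : ζ_p ↦ ζ_p^r` fixing `μ_{2^{a+1}}`, `ω` a primitive
`2^{a+1}`-th root of unity; a singular block with a non-zero type forces `ω² ∈ N_{L/L₀}(L^×)`, a norm of degree four.  This file is
the arithmetic half of the refutation, in the style of `CorCM/CyclotomicTwoPowerPResidueDescent` (degree two): in
`Λ = ℤ[X]/(Φ_{2^{a+1}p})` with generator `μ`, `η = −μ^{2^a}`, `g = 1 + μ^{2^a} = 1 − η`, for ANY ring endomorphism `σ` of `Λ` with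
`σ(μ) = μ^e` and ANY residue map `π : Λ → k` (`k ⊇ 𝔽_p` a field, `π(μ) = s`, `s^{2^a} = −1`):

THEOREM (`descent4`).  If `a ≥ 1` and NO `x ∈ k` has `x^{2^{a+1}} = −1`, then no `Z ∈ Λ`, `n ≥ 1`, `t₀` odd and `U ∈ Λ` with `π(U)` a
non-zero fourth power satisfy `Z · σZ · σ²Z · σ³Z = n⁴ μ^{p (2 t₀)} U` (`μ^{2pt₀} = ω²`).
PROOF.  `π ∘ σ = π`, `π_R ∘ σ = π_R` (`e ≡ 1 (mod 2^{a+1})`).  If `p ∤ n`: `x = π(Z)/(n̄ c)` has `x⁴ = s^{2pt₀}`, so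
`x^{2^{a+1}} = (s^{2^a})^{p t₀} = −1` — excluded.  If `p ∣ n`: `π_R(Z)⁴ = 0`, `R = 𝔽_p[X]/(X^{2^a}+1)` reduced, so `Z = g Z₁`;
`σ^i(g) = g · u_i`, `u_i = 1 + η + ⋯ + η^{e^i − 1}`, with inverse `v_i = Σ_{t < e^{4−i}} η^{e^i t}` (`e⁴ ≡ 1 (mod p)`), and
`p = g^{p−1} ε`: peel `p − 1` times four factors of `g` and recurse on `n/p` (`π(v₁v₂v₃) = e⁶ = −1`, squared away over the even number
`p − 1` of peels; `π(ε) = (p−1)! ≠ 0`).  Mathlib + `CorCM/CyclotomicTwoPowerPIntegers` only.  KERNEL ONLY: theorems; no definition, no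
named fact, no `sorry`.

* §1 the exponent: `coprime_exp`, `pow_four_mul_mod`, `cast_pow_six` (`Residue.odd_exp` is reused).
* §2 units: `map_one_add_root_pow` (`τ(g) = g · Σ_{t<f} η^t` for `τ(μ) = μ^f`, `f` odd), `eta_pow_mod`, `geom_mul_geom_eq_one`.
* §3 residue maps: `liftR_comp_eq`, `pi_comp_eq`, `pi_eta`, `pi_geom`, `pi_eps_ne_zero`.
* §4 `peel4`, `peel4_iter`.   §5 **`descent4`**.

## References

* [FeinGordonSmith1971] B. Fein, B. Gordon, J. H. Smith, J. Number Theory 3 (1971), 310–315 (the `2`-adic prototype).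
* [Washington1997] L. C. Washington, *Introduction to Cyclotomic Fields*, Prop. 2.8, Thm. 2.13.
-/

noncomputable section

open Polynomial

namespace Summit.HodgeConjecture.CorCM.CyclotomicTwoPowerP.Quartic

variable {p a e : ℕ}

/-! ## §1 The exponent `e ≡ 1 (mod 2^{a+1})`, `e² ≡ −1 (mod p)` -/

/-- `gcd(e, 2^{a+1}p) = 1`. [folklore] -/
theorem coprime_exp (hp : p.Prime) (he : e % 2 ^ (a + 1) = 1) (hee : (e ^ 2 + 1) % p = 0) :
    e.Coprime (2 ^ (a + 1) * p) := by
  refine Nat.Coprime.mul_right (Nat.Coprime.pow_right _ (Nat.coprime_two_right.2 (Residue.odd_exp he))) ?_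
  refine Nat.Coprime.symm ((Nat.Prime.coprime_iff_not_dvd hp).2 fun h => ?_)
  have h1 : p ∣ e ^ 2 + 1 := Nat.dvd_of_mod_eq_zero hee
  have h2 : p ∣ e ^ 2 := Dvd.dvd.trans h (Dvd.intro_left _ (sq e).symm)
  have : p ∣ 1 := (Nat.dvd_add_right h2).1 h1
  exact hp.one_lt.ne' (Nat.dvd_one.1 this)

/-- `e² = −1` in `ℤ/p`. [folklore] -/
theorem cast_sq (hee : (e ^ 2 + 1) % p = 0) : ((e : ZMod p)) ^ 2 = -1 := by
  have h1 : ((e ^ 2 + 1 : ℕ) : ZMod p) = 0 := by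
    rw [ZMod.natCast_eq_zero_iff]; exact Nat.dvd_of_mod_eq_zero hee
  push_cast at h1
  linear_combination h1

/-- `e^{4i} ≡ 1 (mod p)`. [folklore] -/
theorem pow_four_mul_mod (hp : p.Prime) (hee : (e ^ 2 + 1) % p = 0) (i : ℕ) : e ^ (4 * i) % p = 1 := by
  have h3 : ((e ^ (4 * i) : ℕ) : ZMod p) = ((1 : ℕ) : ZMod p) := by
    push_cast
    rw [show (e : ZMod p) ^ (4 * i) = (((e : ZMod p) ^ 2) ^ 2) ^ i by ring, cast_sq hee]
    norm_num
  rw [ZMod.natCast_eq_natCast_iff'] at h3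
  rw [h3, Nat.mod_eq_of_lt hp.one_lt]

/-- `e⁶ = −1` in any `𝔽_p`-algebra `k`. [folklore] -/
theorem cast_pow_six {k : Type*} [Field k] [Algebra (ZMod p) k] (hee : (e ^ 2 + 1) % p = 0) :
    ((e ^ 6 : ℕ) : k) = -1 := by
  have h : ((e ^ 6 : ℕ) : ZMod p) = -1 := by
    push_cast
    rw [show (e : ZMod p) ^ 6 = ((e : ZMod p) ^ 2) ^ 3 by ring, cast_sq hee]
    norm_num
  rw [← map_natCast (algebraMap (ZMod p) k), h, map_neg, map_one]

/-! ## §2 Units: `τ(g) = g · (1 + η + ⋯ + η^{f−1})` and its inverse -/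

section Units

/-- `η^m = η^{m mod p}` for the primitive `p`-th root `η = −μ^{2^a}`. [folklore] -/
theorem eta_pow_mod (hp : p.Prime) (hp2 : p ≠ 2) (m : ℕ) :
    (-(AdjoinRoot.root (cyclotomic (2 ^ (a + 1) * p) ℤ)) ^ 2 ^ a) ^ m =
      (-(AdjoinRoot.root (cyclotomic (2 ^ (a + 1) * p) ℤ)) ^ 2 ^ a) ^ (m % p) := by
  have hη := isPrimitiveRoot_eta (a := a) hp hp2
  conv_lhs => rw [← Nat.div_add_mod m p, pow_add, pow_mul, hη.pow_eq_one, one_pow, one_mul]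

/-- **`τ(g) = g · Σ_{t<f} η^t`** for every ring endomorphism `τ` of `Λ` with `τ(μ) = μ^f`, `f` odd (`g = 1 + μ^{2^a} = 1 − η`,
`τ(η) = η^f`). [cite: Washington1997, Prop. 2.8] -/
theorem map_one_add_root_pow (τ : AdjoinRoot (cyclotomic (2 ^ (a + 1) * p) ℤ) →+* AdjoinRoot (cyclotomic (2 ^ (a + 1) * p) ℤ))
    {f : ℕ} (hf : Odd f) (hτ : τ (AdjoinRoot.root (cyclotomic (2 ^ (a + 1) * p) ℤ)) =
      AdjoinRoot.root (cyclotomic (2 ^ (a + 1) * p) ℤ) ^ f) :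
    τ (1 + AdjoinRoot.root (cyclotomic (2 ^ (a + 1) * p) ℤ) ^ 2 ^ a) =
      (1 + AdjoinRoot.root (cyclotomic (2 ^ (a + 1) * p) ℤ) ^ 2 ^ a) *
        ∑ t ∈ Finset.range f, ((-(AdjoinRoot.root (cyclotomic (2 ^ (a + 1) * p) ℤ)) ^ 2 ^ a)) ^ t := by
  set μ := AdjoinRoot.root (cyclotomic (2 ^ (a + 1) * p) ℤ) with hμ_def
  have h1 : τ (1 + μ ^ 2 ^ a) = 1 - (-(μ ^ 2 ^ a)) ^ f := by
    rw [map_add, map_one, map_pow, hτ, ← pow_mul, show f * 2 ^ a = 2 ^ a * f from mul_comm _ _, pow_mul, neg_pow,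
      hf.neg_one_pow]; ring
  rw [h1, ← mul_neg_geom_sum, sub_neg_eq_add]

/-- **`(Σ_{t<f} η^t) · (Σ_{t<d} η^{ft}) = 1`** when `f d ≡ 1 (mod p)` (both factors times `1 − η` give `1 − η^f`, resp.
`1 − η^{fd} = 1 − η`). [folklore] -/
theorem geom_mul_geom_eq_one (hp : p.Prime) (hp2 : p ≠ 2) {f d : ℕ} (hfd : f * d % p = 1) :
    (∑ t ∈ Finset.range f, ((-(AdjoinRoot.root (cyclotomic (2 ^ (a + 1) * p) ℤ)) ^ 2 ^ a)) ^ t) *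
      (∑ t ∈ Finset.range d, (((-(AdjoinRoot.root (cyclotomic (2 ^ (a + 1) * p) ℤ)) ^ 2 ^ a)) ^ f) ^ t) = 1 := by
  haveI := isDomain (a := a) hp.pos
  set η := -(AdjoinRoot.root (cyclotomic (2 ^ (a + 1) * p) ℤ)) ^ 2 ^ a with hη_def
  have hη := isPrimitiveRoot_eta (a := a) hp hp2
  have hne : (1 : AdjoinRoot (cyclotomic (2 ^ (a + 1) * p) ℤ)) - η ≠ 0 := by
    intro h
    have : η = 1 := (sub_eq_zero.1 h).symm
    exact hη.ne_one hp.one_lt this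
  have h1 : (1 - η) * ∑ t ∈ Finset.range f, η ^ t = 1 - η ^ f := mul_neg_geom_sum η f
  have h2 : (1 - η ^ f) * ∑ t ∈ Finset.range d, (η ^ f) ^ t = 1 - η := by
    rw [mul_neg_geom_sum, ← pow_mul, eta_pow_mod hp hp2, hfd, pow_one]
  have h3 : (1 - η) * ((∑ t ∈ Finset.range f, η ^ t) * ∑ t ∈ Finset.range d, (η ^ f) ^ t) = (1 - η) * 1 := by
    rw [← mul_assoc, h1, h2, mul_one]
  exact mul_left_cancel₀ hne h3

end Units

/-! ## §3 The residue maps commute with `σ` -/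

section Residue

variable {k : Type*} [Field k] [Algebra (ZMod p) k]

/-- **`π_R ∘ σ = π_R`** on `R = 𝔽_p[X]/(X^{2^a}+1)` for every `σ` with `σ(μ) = μ^e`, `e ≡ 1 (mod 2^{a+1})`. [folklore] -/
theorem liftR_comp_eq (hp : p.Prime) (hp2 : p ≠ 2) (he : e % 2 ^ (a + 1) = 1)
    (σ : AdjoinRoot (cyclotomic (2 ^ (a + 1) * p) ℤ) →+* AdjoinRoot (cyclotomic (2 ^ (a + 1) * p) ℤ))
    (hσ : σ (AdjoinRoot.root (cyclotomic (2 ^ (a + 1) * p) ℤ)) = AdjoinRoot.root (cyclotomic (2 ^ (a + 1) * p) ℤ) ^ e)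
    (Z : AdjoinRoot (cyclotomic (2 ^ (a + 1) * p) ℤ)) :
    AdjoinRoot.lift (Int.castRingHom _) (AdjoinRoot.root (X ^ 2 ^ a + 1 : (ZMod p)[X])) (eval₂_cyclotomic_R hp hp2) (σ Z) =
      AdjoinRoot.lift (Int.castRingHom _) (AdjoinRoot.root (X ^ 2 ^ a + 1 : (ZMod p)[X])) (eval₂_cyclotomic_R hp hp2) Z := by
  have hdm := Nat.div_add_mod e (2 ^ (a + 1))
  rw [he] at hdm
  have key := CyclotomicFourP.ringHom_ext (T := AdjoinRoot (X ^ 2 ^ a + 1 : (ZMod p)[X]))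
    (φ₁ := (AdjoinRoot.lift (Int.castRingHom _) (AdjoinRoot.root (X ^ 2 ^ a + 1 : (ZMod p)[X]))
      (eval₂_cyclotomic_R hp hp2)).comp σ)
    (φ₂ := AdjoinRoot.lift (Int.castRingHom _) (AdjoinRoot.root (X ^ 2 ^ a + 1 : (ZMod p)[X]))
      (eval₂_cyclotomic_R hp hp2)) (by
      rw [RingHom.comp_apply, hσ, map_pow, AdjoinRoot.lift_root, ← hdm, pow_succ, pow_mul, rootR_pow, one_pow, one_mul])
  exact DFunLike.congr_fun key Z

omit [Algebra (ZMod p) k] in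
/-- **`π ∘ σ = π`** for every residue map `π : Λ → k` with `π(μ) = s`, `s^{2^a} = −1` (`s^e = s`). [folklore] -/
theorem pi_comp_eq (he : e % 2 ^ (a + 1) = 1)
    (σ : AdjoinRoot (cyclotomic (2 ^ (a + 1) * p) ℤ) →+* AdjoinRoot (cyclotomic (2 ^ (a + 1) * p) ℤ))
    (hσ : σ (AdjoinRoot.root (cyclotomic (2 ^ (a + 1) * p) ℤ)) = AdjoinRoot.root (cyclotomic (2 ^ (a + 1) * p) ℤ) ^ e)
    (π : AdjoinRoot (cyclotomic (2 ^ (a + 1) * p) ℤ) →+* k) {s : k}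
    (hπ : π (AdjoinRoot.root (cyclotomic (2 ^ (a + 1) * p) ℤ)) = s) (hs : s ^ 2 ^ a = -1)
    (Z : AdjoinRoot (cyclotomic (2 ^ (a + 1) * p) ℤ)) : π (σ Z) = π Z := by
  have hs2 : s ^ 2 ^ (a + 1) = 1 := by rw [pow_succ, pow_mul, hs, neg_one_sq]
  have hdm := Nat.div_add_mod e (2 ^ (a + 1))
  rw [he] at hdm
  have key := CyclotomicFourP.ringHom_ext (T := k) (φ₁ := π.comp σ) (φ₂ := π) (by
    rw [RingHom.comp_apply, hσ, map_pow, hπ, ← hdm, pow_succ, pow_mul, hs2, one_pow, one_mul])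
  exact DFunLike.congr_fun key Z

omit [Algebra (ZMod p) k] in
/-- `π(η) = 1`. [folklore] -/
theorem pi_eta (π : AdjoinRoot (cyclotomic (2 ^ (a + 1) * p) ℤ) →+* k) {s : k}
    (hπ : π (AdjoinRoot.root (cyclotomic (2 ^ (a + 1) * p) ℤ)) = s) (hs : s ^ 2 ^ a = -1) :
    π (-(AdjoinRoot.root (cyclotomic (2 ^ (a + 1) * p) ℤ)) ^ 2 ^ a) = 1 := by
  rw [map_neg, map_pow, hπ, hs, neg_neg]

omit [Algebra (ZMod p) k] in
/-- `π(Σ_{t<d} (η^f)^t) = d`. [folklore] -/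
theorem pi_geom (π : AdjoinRoot (cyclotomic (2 ^ (a + 1) * p) ℤ) →+* k) {s : k}
    (hπ : π (AdjoinRoot.root (cyclotomic (2 ^ (a + 1) * p) ℤ)) = s) (hs : s ^ 2 ^ a = -1) (f d : ℕ) :
    π (∑ t ∈ Finset.range d, (((-(AdjoinRoot.root (cyclotomic (2 ^ (a + 1) * p) ℤ)) ^ 2 ^ a)) ^ f) ^ t) = (d : k) := by
  rw [map_sum]
  simp_rw [map_pow, pi_eta π hπ hs, one_pow]
  simp

/-- **`π(ε) = (p−1)! ≠ 0`** for `ε = ∏_{j<p−1} (1 + η + ⋯ + η^j)`. [folklore] -/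
theorem pi_eps_ne_zero (hp : p.Prime) (π : AdjoinRoot (cyclotomic (2 ^ (a + 1) * p) ℤ) →+* k) {s : k}
    (hπ : π (AdjoinRoot.root (cyclotomic (2 ^ (a + 1) * p) ℤ)) = s) (hs : s ^ 2 ^ a = -1) :
    π (∏ j ∈ Finset.range (p - 1), ∑ m ∈ Finset.range (j + 1),
        (-(AdjoinRoot.root (cyclotomic (2 ^ (a + 1) * p) ℤ)) ^ 2 ^ a) ^ m) ≠ 0 := by
  haveI : Fact p.Prime := ⟨hp⟩
  rw [map_prod]
  have hfac : ∀ j : ℕ, π (∑ m ∈ Finset.range (j + 1), (-(AdjoinRoot.root (cyclotomic (2 ^ (a + 1) * p) ℤ)) ^ 2 ^ a) ^ m) =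
      ((j + 1 : ℕ) : k) := fun j => by
    rw [map_sum]
    simp_rw [map_pow, pi_eta π hπ hs, one_pow]
    simp
  simp_rw [hfac]
  rw [← Nat.cast_prod, Finset.prod_range_add_one_eq_factorial, ← map_natCast (algebraMap (ZMod p) k),
    ZMod.wilsons_lemma, map_neg, map_one]
  exact neg_ne_zero.2 one_ne_zero

end Residue

/-! ## §4 One `g`-adic step for the degree-four norm -/

section Peel

/-- **Peeling four factors of `g`.**  If `Z σZ σ²Z σ³Z = g^{4(n+1)} V` then `Z = g Z₁` with
`Z₁ σZ₁ σ²Z₁ σ³Z₁ = g^{4n} (v₁ v₂ v₃ V)`, `v_i = Σ_{t<e^{4−i}} η^{e^i t}`. [cite: Washington1997, Prop. 2.8] -/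
theorem peel4 (hp : p.Prime) (hp2 : p ≠ 2) (he : e % 2 ^ (a + 1) = 1) (hee : (e ^ 2 + 1) % p = 0)
    (σ : AdjoinRoot (cyclotomic (2 ^ (a + 1) * p) ℤ) →+* AdjoinRoot (cyclotomic (2 ^ (a + 1) * p) ℤ))
    (hσ : σ (AdjoinRoot.root (cyclotomic (2 ^ (a + 1) * p) ℤ)) = AdjoinRoot.root (cyclotomic (2 ^ (a + 1) * p) ℤ) ^ e)
    (n : ℕ) (Z V : AdjoinRoot (cyclotomic (2 ^ (a + 1) * p) ℤ))
    (hZ : Z * σ Z * σ (σ Z) * σ (σ (σ Z)) = (1 + AdjoinRoot.root (cyclotomic (2 ^ (a + 1) * p) ℤ) ^ 2 ^ a) ^ (4 * (n + 1)) * V) :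
    ∃ Z₁ : AdjoinRoot (cyclotomic (2 ^ (a + 1) * p) ℤ),
      Z₁ * σ Z₁ * σ (σ Z₁) * σ (σ (σ Z₁)) = (1 + AdjoinRoot.root (cyclotomic (2 ^ (a + 1) * p) ℤ) ^ 2 ^ a) ^ (4 * n) *
        (((∑ t ∈ Finset.range (e ^ 3), (((-(AdjoinRoot.root (cyclotomic (2 ^ (a + 1) * p) ℤ)) ^ 2 ^ a)) ^ e) ^ t) *
          (∑ t ∈ Finset.range (e ^ 2), (((-(AdjoinRoot.root (cyclotomic (2 ^ (a + 1) * p) ℤ)) ^ 2 ^ a)) ^ (e ^ 2)) ^ t) *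
          (∑ t ∈ Finset.range e, (((-(AdjoinRoot.root (cyclotomic (2 ^ (a + 1) * p) ℤ)) ^ 2 ^ a)) ^ (e ^ 3)) ^ t)) * V) := by
  haveI := isDomain (a := a) hp.pos
  set μ := AdjoinRoot.root (cyclotomic (2 ^ (a + 1) * p) ℤ) with hμ_def
  set η := -μ ^ 2 ^ a with hη_def
  set πR := AdjoinRoot.lift (Int.castRingHom _) (AdjoinRoot.root (X ^ 2 ^ a + 1 : (ZMod p)[X]))
    (eval₂_cyclotomic_R (a := a) hp hp2) with hπR_def
  have hodd := Residue.odd_exp he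
  -- the three conjugates of `g`
  have hσ2 : (σ.comp σ) μ = μ ^ (e ^ 2) := by rw [RingHom.comp_apply, hσ, map_pow, hσ, ← pow_mul, sq]
  have hσ3 : (σ.comp (σ.comp σ)) μ = μ ^ (e ^ 3) := by
    rw [RingHom.comp_apply, hσ2, map_pow, hσ, ← pow_mul, show e * e ^ 2 = e ^ 3 by ring]
  have hg1 := map_one_add_root_pow σ hodd hσ
  have hg2 := map_one_add_root_pow (σ.comp σ) (hodd.pow) hσ2
  have hg3 := map_one_add_root_pow (σ.comp (σ.comp σ)) (hodd.pow) hσ3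
  simp only [RingHom.comp_apply] at hg2 hg3
  -- `π_R(Z)⁴ = 0`, hence `π_R(Z) = 0`
  have hvan : πR Z = 0 := by
    have h := congrArg πR hZ
    rw [map_mul, map_mul, map_mul, hπR_def, liftR_comp_eq hp hp2 he σ hσ, liftR_comp_eq hp hp2 he σ hσ,
      liftR_comp_eq hp hp2 he σ hσ, liftR_comp_eq hp hp2 he σ hσ, liftR_comp_eq hp hp2 he σ hσ,
      liftR_comp_eq hp hp2 he σ hσ, map_mul, map_pow, liftR_one_add_root_pow hp hp2, zero_pow (by omega), zero_mul] at h
    have h2 : (AdjoinRoot.lift (Int.castRingHom _) (AdjoinRoot.root (X ^ 2 ^ a + 1 : (ZMod p)[X]))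
        (eval₂_cyclotomic_R (a := a) hp hp2) Z) ^ 2 = 0 := by
      refine eq_zero_of_sq_eq_zero_R hp hp2 _ ?_
      rw [← h]; ring
    exact eq_zero_of_sq_eq_zero_R hp hp2 _ h2
  obtain ⟨Z₁, rfl⟩ := exists_eq_mul_of_liftR_eq_zero hp hp2 Z hvan
  refine ⟨Z₁, ?_⟩
  have hg := one_add_root_pow_ne_zero (a := a) hp hp2
  -- units and their inverses
  have hu1 := geom_mul_geom_eq_one (a := a) hp hp2 (f := e) (d := e ^ 3)
    (by rw [← pow_succ', show 3 + 1 = 4 * 1 by norm_num]; exact pow_four_mul_mod hp hee 1)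
  have hu2 := geom_mul_geom_eq_one (a := a) hp hp2 (f := e ^ 2) (d := e ^ 2)
    (by rw [← pow_add, show 2 + 2 = 4 * 1 by norm_num]; exact pow_four_mul_mod hp hee 1)
  have hu3 := geom_mul_geom_eq_one (a := a) hp hp2 (f := e ^ 3) (d := e)
    (by rw [← pow_succ, show 3 + 1 = 4 * 1 by norm_num]; exact pow_four_mul_mod hp hee 1)
  simp only [map_mul] at hZ
  rw [hg3, hg2, hg1] at hZ
  -- cancel `g⁴`
  have e4 : (1 + μ ^ 2 ^ a) ^ (4 * (n + 1)) = (1 + μ ^ 2 ^ a) ^ 4 * (1 + μ ^ 2 ^ a) ^ (4 * n) := by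
    rw [← pow_add]; congr 1; ring
  rw [e4] at hZ
  have h2 : (1 + μ ^ 2 ^ a) ^ 4 * ((∑ t ∈ Finset.range e, η ^ t) * (∑ t ∈ Finset.range (e ^ 2), η ^ t) *
      (∑ t ∈ Finset.range (e ^ 3), η ^ t) * (Z₁ * σ Z₁ * σ (σ Z₁) * σ (σ (σ Z₁)))) =
      (1 + μ ^ 2 ^ a) ^ 4 * ((1 + μ ^ 2 ^ a) ^ (4 * n) * V) := by
    linear_combination hZ
  have h3 := mul_left_cancel₀ (pow_ne_zero 4 hg) h2
  have h4 := congrArg (fun x => (∑ t ∈ Finset.range (e ^ 3), (η ^ e) ^ t) * (∑ t ∈ Finset.range (e ^ 2), (η ^ (e ^ 2)) ^ t) *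
    (∑ t ∈ Finset.range e, (η ^ (e ^ 3)) ^ t) * x) h3
  have h5 : (∑ t ∈ Finset.range (e ^ 3), (η ^ e) ^ t) * (∑ t ∈ Finset.range (e ^ 2), (η ^ (e ^ 2)) ^ t) *
      (∑ t ∈ Finset.range e, (η ^ (e ^ 3)) ^ t) *
      ((∑ t ∈ Finset.range e, η ^ t) * (∑ t ∈ Finset.range (e ^ 2), η ^ t) * (∑ t ∈ Finset.range (e ^ 3), η ^ t) *
        (Z₁ * σ Z₁ * σ (σ Z₁) * σ (σ (σ Z₁)))) =
      ((∑ t ∈ Finset.range e, η ^ t) * ∑ t ∈ Finset.range (e ^ 3), (η ^ e) ^ t) *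
      ((∑ t ∈ Finset.range (e ^ 2), η ^ t) * ∑ t ∈ Finset.range (e ^ 2), (η ^ (e ^ 2)) ^ t) *
      ((∑ t ∈ Finset.range (e ^ 3), η ^ t) * ∑ t ∈ Finset.range e, (η ^ (e ^ 3)) ^ t) *
        (Z₁ * σ Z₁ * σ (σ Z₁) * σ (σ (σ Z₁))) := by ring
  rw [h5, hu1, hu2, hu3, one_mul, one_mul, one_mul] at h4
  rw [h4]
  ring

/-- **Iterated peeling** (degree four). [cite: Washington1997, Prop. 2.8] -/
theorem peel4_iter (hp : p.Prime) (hp2 : p ≠ 2) (he : e % 2 ^ (a + 1) = 1) (hee : (e ^ 2 + 1) % p = 0)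
    (σ : AdjoinRoot (cyclotomic (2 ^ (a + 1) * p) ℤ) →+* AdjoinRoot (cyclotomic (2 ^ (a + 1) * p) ℤ))
    (hσ : σ (AdjoinRoot.root (cyclotomic (2 ^ (a + 1) * p) ℤ)) = AdjoinRoot.root (cyclotomic (2 ^ (a + 1) * p) ℤ) ^ e) :
    ∀ (m : ℕ) (Z V : AdjoinRoot (cyclotomic (2 ^ (a + 1) * p) ℤ)),
      Z * σ Z * σ (σ Z) * σ (σ (σ Z)) = (1 + AdjoinRoot.root (cyclotomic (2 ^ (a + 1) * p) ℤ) ^ 2 ^ a) ^ (4 * m) * V →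
      ∃ Z' : AdjoinRoot (cyclotomic (2 ^ (a + 1) * p) ℤ),
        Z' * σ Z' * σ (σ Z') * σ (σ (σ Z')) =
          ((∑ t ∈ Finset.range (e ^ 3), (((-(AdjoinRoot.root (cyclotomic (2 ^ (a + 1) * p) ℤ)) ^ 2 ^ a)) ^ e) ^ t) *
            (∑ t ∈ Finset.range (e ^ 2), (((-(AdjoinRoot.root (cyclotomic (2 ^ (a + 1) * p) ℤ)) ^ 2 ^ a)) ^ (e ^ 2)) ^ t) *
            (∑ t ∈ Finset.range e, (((-(AdjoinRoot.root (cyclotomic (2 ^ (a + 1) * p) ℤ)) ^ 2 ^ a)) ^ (e ^ 3)) ^ t)) ^ m * V := by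
  intro m
  induction m with
  | zero =>
    intro Z V h
    exact ⟨Z, by rw [h, mul_zero, pow_zero, one_mul, pow_zero, one_mul]⟩
  | succ m ih =>
    intro Z V h
    obtain ⟨Z₁, h₁⟩ := peel4 hp hp2 he hee σ hσ m Z V h
    obtain ⟨Z', h'⟩ := ih Z₁ _ h₁
    exact ⟨Z', by rw [h', ← mul_assoc, ← pow_succ]⟩

end Peel

/-! ## §5 The descent -/

/-- **THE DEGREE-FOUR DESCENT THROUGH A RESIDUE FIELD** (`a ≥ 1`; `e ≡ 1 (mod 2^{a+1})`, `e² ≡ −1 (mod p)`; `σ(μ) = μ^e`;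
`k ⊇ 𝔽_p` a field, `π(μ) = s`, `s^{2^a} = −1`, and NO `x ∈ k` with `x^{2^{a+1}} = −1`; `t₀` odd): no `n ≥ 1`, `Z, U ∈ Λ`, `c ∈ kˣ`
with `π(U) = c⁴` satisfy `Z σZ σ²Z σ³Z = n⁴ μ^{p(2t₀)} U` — `ω² = μ^{2pt₀}` is not a norm of degree four.
[cite: FeinGordonSmith1971, pp. 310–315] -/
theorem descent4 (hp : p.Prime) (hp2 : p ≠ 2) (ha : 1 ≤ a) (he : e % 2 ^ (a + 1) = 1) (hee : (e ^ 2 + 1) % p = 0)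
    (σ : AdjoinRoot (cyclotomic (2 ^ (a + 1) * p) ℤ) →+* AdjoinRoot (cyclotomic (2 ^ (a + 1) * p) ℤ))
    (hσ : σ (AdjoinRoot.root (cyclotomic (2 ^ (a + 1) * p) ℤ)) = AdjoinRoot.root (cyclotomic (2 ^ (a + 1) * p) ℤ) ^ e)
    {k : Type*} [Field k] [Algebra (ZMod p) k] (π : AdjoinRoot (cyclotomic (2 ^ (a + 1) * p) ℤ) →+* k) {s : k}
    (hπ : π (AdjoinRoot.root (cyclotomic (2 ^ (a + 1) * p) ℤ)) = s) (hs : s ^ 2 ^ a = -1)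
    (hk : ∀ x : k, x ^ 2 ^ (a + 1) ≠ -1) {t₀ : ℕ} (ht₀ : Odd t₀) :
    ∀ (n : ℕ), 0 < n → ∀ (Z U : AdjoinRoot (cyclotomic (2 ^ (a + 1) * p) ℤ)) (c : k), c ≠ 0 → π U = c ^ 4 →
      Z * σ Z * σ (σ Z) * σ (σ (σ Z)) =
        (n : AdjoinRoot (cyclotomic (2 ^ (a + 1) * p) ℤ)) ^ 4 *
          (AdjoinRoot.root (cyclotomic (2 ^ (a + 1) * p) ℤ) ^ (p * (2 * t₀)) * U) →
      False := by
  haveI := isDomain (a := a) hp.pos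
  haveI : Fact p.Prime := ⟨hp⟩
  obtain ⟨a', rfl⟩ : ∃ a', a = a' + 1 := ⟨a - 1, by omega⟩
  set μ := AdjoinRoot.root (cyclotomic (2 ^ (a' + 1 + 1) * p) ℤ) with hμ_def
  set W := (∑ t ∈ Finset.range (e ^ 3), ((-μ ^ 2 ^ (a' + 1)) ^ e) ^ t) *
    (∑ t ∈ Finset.range (e ^ 2), ((-μ ^ 2 ^ (a' + 1)) ^ (e ^ 2)) ^ t) *
    (∑ t ∈ Finset.range e, ((-μ ^ 2 ^ (a' + 1)) ^ (e ^ 3)) ^ t) with hW_def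
  have hπσ : ∀ Z, π (σ Z) = π Z := pi_comp_eq he σ hσ π hπ hs
  set ε := ∏ j ∈ Finset.range (p - 1), ∑ m ∈ Finset.range (j + 1), (-μ ^ 2 ^ (a' + 1)) ^ m with hε_def
  have hpε : ((p : ℕ) : AdjoinRoot (cyclotomic (2 ^ (a' + 1 + 1) * p) ℤ)) = (1 + μ ^ 2 ^ (a' + 1)) ^ (p - 1) * ε :=
    prime_eq_pow_mul hp hp2
  have hπε : π ε ≠ 0 := pi_eps_ne_zero hp π hπ hs
  have hπW : π W = -1 := by
    rw [hW_def, map_mul, map_mul, pi_geom π hπ hs, pi_geom π hπ hs, pi_geom π hπ hs, ← Nat.cast_mul, ← Nat.cast_mul,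
      show e ^ 3 * e ^ 2 * e = e ^ 6 by ring]
    exact cast_pow_six hee
  obtain ⟨h2, hh2⟩ := hp.even_sub_one hp2
  have hπWp : π W ^ (p - 1) = 1 := by rw [hπW, hh2, ← two_mul, pow_mul, neg_one_sq, one_pow]
  -- `π(μ^{p(2t₀)})` raised to `2^{a'}` is `−1`
  have hω : (π (μ ^ (p * (2 * t₀)))) ^ 2 ^ a' = -1 := by
    rw [map_pow, hπ, ← pow_mul, show p * (2 * t₀) * 2 ^ a' = 2 ^ (a' + 1) * (p * t₀) by rw [pow_succ]; ring, pow_mul, hs]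
    exact ((hp.odd_of_ne_two hp2).mul ht₀).neg_one_pow
  intro n
  induction n using Nat.strong_induction_on with
  | _ n ih =>
  intro hn Z U c hc hU hrel
  by_cases hpn : p ∣ n
  · obtain ⟨n', rfl⟩ := hpn
    have hn' : 0 < n' := Nat.pos_of_mul_pos_left hn
    have hrel' : Z * σ Z * σ (σ Z) * σ (σ (σ Z)) = (1 + μ ^ 2 ^ (a' + 1)) ^ (4 * (p - 1)) *
        (ε ^ 4 * ((n' : AdjoinRoot (cyclotomic (2 ^ (a' + 1 + 1) * p) ℤ)) ^ 4 * (μ ^ (p * (2 * t₀)) * U))) := by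
      rw [hrel, Nat.cast_mul, hpε]; ring
    obtain ⟨Z', hZ'⟩ := peel4_iter hp hp2 he hee σ hσ (p - 1) Z _ hrel'
    refine ih n' (by have := hp.two_le; nlinarith) hn' Z' (W ^ (p - 1) * ε ^ 4 * U) (π ε * c)
      (mul_ne_zero hπε hc) ?_ ?_
    · rw [map_mul, map_mul, map_pow, map_pow, hπWp, hU]; ring
    · rw [hZ']; ring
  · have hnz : ((n : ℕ) : k) ≠ 0 := by
      rw [← map_natCast (algebraMap (ZMod p) k), _root_.map_ne_zero, Ne, ZMod.natCast_eq_zero_iff]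
      exact hpn
    have h := congrArg π hrel
    rw [map_mul, map_mul, map_mul, hπσ, hπσ, hπσ, hπσ, hπσ, hπσ, map_mul, map_mul, map_pow, map_natCast, hU] at h
    set x : k := π Z / ((n : k) * c) with hx_def
    have hx4 : x ^ 4 = π (μ ^ (p * (2 * t₀))) := by
      rw [hx_def, div_pow, div_eq_iff (pow_ne_zero 4 (mul_ne_zero hnz hc))]
      linear_combination h
    have hx : x ^ 2 ^ (a' + 1 + 1) = -1 := by
      rw [show 2 ^ (a' + 1 + 1) = 4 * 2 ^ a' by rw [pow_succ, pow_succ]; ring, pow_mul, hx4, hω]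
    exact hk x hx

end Summit.HodgeConjecture.CorCM.CyclotomicTwoPowerP.Quartic

end
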